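import Mathlib
import Literature.Analysis.FluidPDE.Tao2016AveragedNS.SelfSimilarCascadeResidues
import Literature.Analysis.FluidPDE.Tao2016AveragedNS.CascadeTableDictionary
import Summits.NavierStokesRegularity.NavierStokesRegularity.Theorems.TaoLadderRungTwoBreakDSSWaveOfQuadTermDatum
import Summits.NavierStokesRegularity.NavierStokesRegularity.Theorems.TaoLadderRungTwoBreakDSSWaveOfBallDatum
import Summits.NavierStokesRegularity.NavierStokesRegularity.Theorems.TaoLadderRungTwoBreakBlowupRigidityOneCriticalBlowup
import HarnessLib

/-!
# ENERGY BOUND for the exact cascade flow of a cancelling table and «THE BLOW-UP ESCAPES TO ARBITRARILY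
  HIGH SHELLS»: along the maximal exact flow of a robustly blowing-up `E₂(R)` table every partial energy
  `Σ_{k ≤ K} ‖x_k(t)‖²` is at most the datum energy `Σ_i X₀ᵢ²`, so `|X_{i,k}(t)| ≤ ‖X₀‖` on `[0,T⋆)` and
  the unbounded critical amplitude `sup_k Λ^k|X_{i,k}(t)|` must be realised on shells `k → ∞` — support
  for the extraction stub of K2(1) `TaoLadderRungTwoBreak.BlowupRigidityOne` (stmt-NavierStokesRegularity-20206)

MODEL lattice ODEs only (Tao 2016 §4: (4.3) cancellation ⇒ `⟨C(u,u),u⟩ = 0`; Lemma 4.1 (4.9)–(4.10)); nothing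
here is a statement about the Navier–Stokes equations; NO item is closed (`--supports
stmt-NavierStokesRegularity-20206`). Route-independent; general `m`.

* `shellEnergy_hasDerivWithinAt` — per-shell energy balance of an exact flow of a CANCELLING table:
  `d/dt ‖x_k‖² = f_{k-1} - f_k`, `f_k = 2Λ^k⟪x_{k+1}, A x_k⟫` (intra-shell neutrality and the type-split
  cancellation of `table_sTable`);
* `partialEnergy_le_datumEnergy` — for an exact flow from the one-shell datum `X₀` at shell `0` (no shells
  below `0`, (4.5)-regular on every `[0,T']`, `T' < T`): `Σ_{k=0}^{K} ‖x_k(t)‖² ≤ Σ_i X₀ᵢ²` for all `K` and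
  `t < T` (telescoping, the top flux `f_K` is `O((1+ε₀)^{-15K/2})` by the a priori weight, let `K → ∞`);
  `abs_le_datumNorm` — hence `|X_{i,k}(t)| ≤ √(Σ_i X₀ᵢ²)`;
* `highShellBlowup_of_noGlobalCascade` — with `criticalBlowup_of_noGlobalCascade`: robust blow-up ⇒ for
  every shell index `K` and level `L` there are `t < T⋆`, a mode `i` and a shell `k > K` with
  `Λ^k|X_{i,k}(t)| > L` — the cascade reaches arbitrarily high shells with critical-size amplitude before
  `T⋆` (frames of any ω-limit must be centred at shells `m_j → ∞`).
-/

noncomputable section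

-- the summit and its single sub-problem share the name (CONVENTIONS §1)
set_option linter.dupNamespace false

open Set Filter Topology Finset
open scoped RealInnerProductSpace

namespace Summit.NavierStokesRegularity.NavierStokesRegularity.Theorems

namespace BlowupRigidityOne

open Literature.Analysis.FluidPDE Literature.Analysis.FluidPDE.TaoCascade
open DSSOneShift (hasDerivWithinAt_shellVec shellVec_quadTerm_normalForm norm_shellVec_le_sqrt_mul)

variable {m : ℕ}

/-! ### Per-shell energy balance -/

/-- **Per-shell energy balance of an exact flow of a cancelling table.** If every component has the
one-sided exact law `HasDerivWithinAt (X i k) (quadTerm_{i,k}(X)(t)) [0,∞) t`, then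
`d/dt ‖x_k(t)‖² = f_{k-1}(t) - f_k(t)` within `[0,∞)`, with the flux `f_k = 2Λ^k⟪x_{k+1}, A(x_k)⟫`
(`⟪x, Qx⟫ = 0` and `⟪x_k, B(x_{k+1},x_k)⟫ = -⟪x_{k+1}, A x_k⟫` by (4.3), `table_sTable`).
[cite: Tao2016AveragedNS, §4 (4.3) and Lemma 4.1 (4.9)–(4.10)] -/
theorem shellEnergy_hasDerivWithinAt {ε₀ : ℝ} (hε : 0 < ε₀)
    {α : Fin m → Fin m → Fin m → ℤ × ℤ × ℤ → ℝ} (hc : IsCancellingCoeff α)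
    {X : Fin m → ℤ → ℝ → ℝ} {k : ℤ} {t : ℝ}
    (hder : ∀ i, HasDerivWithinAt (X i k) (quadTerm ε₀ α X i k t) (Ici 0) t) :
    HasDerivWithinAt (fun s => ‖shellVec X k s‖ ^ 2)
      (2 * bigLam ε₀ ^ (k - 1) * ⟪shellVec X k t, tableA α (shellVec X (k - 1) t)⟫
        - 2 * bigLam ε₀ ^ k * ⟪shellVec X (k + 1) t, tableA α (shellVec X k t)⟫) (Ici 0) t := by
  have hL : 0 < bigLam ε₀ := bigLam_pos (by linarith)
  have hS := table_sTable α hc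
  have hv : HasDerivWithinAt (shellVec X k) (WithLp.toLp 2 fun i => quadTerm ε₀ α X i k t) (Ici 0) t :=
    hasDerivWithinAt_shellVec hder
  have heq : (WithLp.toLp 2 fun i => quadTerm ε₀ α X i k t : Em m) =
      shellVec (fun i n s => quadTerm ε₀ α X i n s) k t := rfl
  rw [heq, shellVec_quadTerm_normalForm (by linarith) α X k t] at hv
  refine hv.norm_sq.congr_deriv ?_
  rw [real_inner_smul_right, inner_add_right, inner_add_right, real_inner_smul_right, hS.intra]
  have hcan := hS.cancel (shellVec X k t) (shellVec X (k + 1) t)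
  rw [zpow_sub_one₀ hL.ne']
  linear_combination (2 * bigLam ε₀ ^ k) * hcan

/-- `A 0 = 0` for the outflow map of any cancelling table. [cite: Tao2016AveragedNS, §4 (4.1)] -/
theorem tableA_zero {α : Fin m → Fin m → Fin m → ℤ × ℤ × ℤ → ℝ} (hc : IsCancellingCoeff α) :
    tableA α (0 : Em m) = 0 := by
  have h := (table_sTable α hc).normA 0
  rw [norm_zero, zero_pow two_ne_zero, mul_zero] at h
  exact norm_le_zero_iff.1 h

/-! ### The partial energies are bounded by the datum energy -/

/-- **ENERGY BOUND.** Let `ε₀ > 0`, `α` a cancelling table (e.g. `α ∈ E₂(R)`), and `X` an exact flow on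
`[0,T)` from the one-shell datum `X₀` at shell `0` (derivatives within `[0,∞)`, no shells below `0`,
(4.5)-regular on every `[0,T']`, `T' < T`). Then for every `t ∈ [0,T)` and every `K`:
`Σ_{k=0}^{K} ‖x_k(t)‖² ≤ Σ_i X₀ᵢ²`. (Telescoping the shell balances gives
`Σ_{k ≤ K'} ‖x_k(t)‖² = Σ_i X₀ᵢ² - ∫₀ᵗ f_{K'}`; the a priori weight makes `|f_{K'}| ≤ C (1+ε₀)^{-15K'/2}`,
and `K' → ∞`.) [cite: Tao2016AveragedNS, §4 (4.3), Lemma 4.1 (4.5), (4.9)–(4.10)] -/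
theorem partialEnergy_le_datumEnergy {ε₀ T : ℝ} (hε : 0 < ε₀)
    {α : Fin m → Fin m → Fin m → ℤ × ℤ × ℤ → ℝ} (hc : IsCancellingCoeff α)
    {X : Fin m → ℤ → ℝ → ℝ} {X₀ : Fin m → ℝ}
    (hder : ∀ i k, ∀ t ∈ Ico 0 T, HasDerivWithinAt (X i k) (quadTerm ε₀ α X i k t) (Ici 0) t)
    (hinit : ∀ i k, X i k 0 = if k = 0 then X₀ i else 0)
    (hlow : ∀ i k t, k < 0 → X i k t = 0)
    (hreg : ∀ T' : ℝ, T' < T → ∃ M : ℝ, ∀ t ∈ Icc 0 T', ∀ (i : Fin m) (k : ℤ),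
      (1 + (1 + ε₀) ^ ((10 : ℝ) * k)) * |X i k t| ≤ M) :
    ∀ t ∈ Ico 0 T, ∀ K : ℕ,
      ∑ k ∈ Finset.range (K + 1), ‖shellVec X (k : ℤ) t‖ ^ 2 ≤ ∑ i, X₀ i ^ 2 := by
  intro t ht K
  have hl0 : (0 : ℝ) < 1 + ε₀ := by linarith
  have hl1 : (1 : ℝ) < 1 + ε₀ := by linarith
  have hL : 0 < bigLam ε₀ := bigLam_pos (by linarith)
  have hS := table_sTable α hc
  obtain ⟨M₀, hM₀⟩ := hreg t ht.2
  set M : ℝ := max M₀ 0 with hMdef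
  have hM : ∀ τ ∈ Icc (0 : ℝ) t, ∀ (i : Fin m) (k : ℤ), (1 + (1 + ε₀) ^ ((10 : ℝ) * k)) * |X i k τ| ≤ M :=
    fun τ hτ i k => (hM₀ τ hτ i k).trans (le_max_left _ _)
  have hM0 : 0 ≤ M := le_max_right _ _
  -- the flux `f k τ = 2 Λ^k ⟪x_{k+1}, A x_k⟫`
  set f : ℤ → ℝ → ℝ := fun k τ =>
    2 * bigLam ε₀ ^ k * ⟪shellVec X (k + 1) τ, tableA α (shellVec X k τ)⟫ with hfdef
  -- partial energies
  set S : ℕ → ℝ → ℝ := fun K' τ => ∑ k ∈ Finset.range (K' + 1), ‖shellVec X (k : ℤ) τ‖ ^ 2 with hSdef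
  -- the shells below `0` vanish, so `f (-1) = 0`
  have hxneg : ∀ τ, shellVec X (-1) τ = 0 := fun τ => by
    ext i; simp [shellVec, hlow i (-1) τ (by norm_num)]
  have hfneg : ∀ τ, f (-1) τ = 0 := fun τ => by
    simp only [hfdef]
    rw [hxneg, tableA_zero hc, inner_zero_right, mul_zero]
  -- derivative of the partial energy: telescoping
  have hSder : ∀ K' : ℕ, ∀ τ ∈ Icc (0 : ℝ) t,
      HasDerivWithinAt (S K') (-(f K' τ)) (Ici 0) τ := by
    intro K' τ hτ
    have hτT : τ ∈ Ico (0 : ℝ) T := ⟨hτ.1, lt_of_le_of_lt hτ.2 ht.2⟩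
    have hterm : ∀ k ∈ Finset.range (K' + 1), HasDerivWithinAt (fun s => ‖shellVec X (k : ℤ) s‖ ^ 2)
        (f ((k : ℤ) - 1) τ - f k τ) (Ici 0) τ := by
      intro k _
      have h := shellEnergy_hasDerivWithinAt hε hc (k := (k : ℤ)) (fun i => hder i k τ hτT)
      simp only [hfdef, sub_add_cancel]
      exact h
    have hsum := HasDerivWithinAt.sum hterm
    have htel : ∑ k ∈ Finset.range (K' + 1), (f ((k : ℤ) - 1) τ - f k τ) = -(f K' τ) := by
      have h := Finset.sum_range_sub' (fun k : ℕ => f ((k : ℤ) - 1) τ) (K' + 1)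
      have e : ∀ k : ℕ, f (((k + 1 : ℕ) : ℤ) - 1) τ = f (k : ℤ) τ := fun k => by
        congr 1; push_cast; ring
      simp only [e] at h
      rw [h]
      push_cast
      rw [hfneg, zero_sub]
    rw [htel, Finset.sum_fn] at hsum
    exact hsum
  -- bound on the top flux via the a priori weight
  have hW1 : ∀ k : ℤ, (1 : ℝ) ≤ 1 + (1 + ε₀) ^ ((10 : ℝ) * k) := fun k => by
    linarith [Real.rpow_nonneg hl0.le ((10 : ℝ) * k)]
  have hcomp : ∀ τ ∈ Icc (0 : ℝ) t, ∀ (i : Fin m) (k : ℤ), |X i k τ| ≤ M / (1 + (1 + ε₀) ^ ((10 : ℝ) * k)) :=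
    fun τ hτ i k => by
      rw [le_div_iff₀ (lt_of_lt_of_le one_pos (hW1 k)), mul_comm]; exact hM τ hτ i k
  have hxle : ∀ τ ∈ Icc (0 : ℝ) t, ∀ k : ℤ, ‖shellVec X k τ‖ ≤ Real.sqrt m * (M / (1 + (1 + ε₀) ^ ((10 : ℝ) * k))) :=
    fun τ hτ k => norm_shellVec_le_sqrt_mul (div_nonneg hM0 (lt_of_lt_of_le one_pos (hW1 k)).le)
      (fun i => hcomp τ hτ i k)
  have hxle' : ∀ τ ∈ Icc (0 : ℝ) t, ∀ k : ℤ, ‖shellVec X k τ‖ ≤ Real.sqrt m * M := fun τ hτ k =>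
    (hxle τ hτ k).trans (mul_le_mul_of_nonneg_left (div_le_self hM0 (hW1 k)) (Real.sqrt_nonneg _))
  -- the decay ratio `q = Λ / (1+ε₀)^10 < 1`
  set q : ℝ := bigLam ε₀ / (1 + ε₀) ^ (10 : ℝ) with hqdef
  have hP10 : 0 < (1 + ε₀) ^ (10 : ℝ) := Real.rpow_pos_of_pos hl0 _
  have hq0 : 0 ≤ q := div_nonneg hL.le hP10.le
  have hq1 : q < 1 := by
    rw [hqdef, div_lt_one hP10]
    unfold bigLam
    exact Real.rpow_lt_rpow_of_exponent_lt hl1 (by norm_num)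
  set Cf : ℝ := 2 * fluxConst α * (Real.sqrt m * M) ^ 3 with hCfdef
  have hCf0 : 0 ≤ Cf := by
    have := fluxConst_nonneg α
    positivity
  have hfbound : ∀ K' : ℕ, ∀ τ ∈ Icc (0 : ℝ) t, |f K' τ| ≤ Cf * q ^ K' := by
    intro K' τ hτ
    have hA := hS.normA (shellVec X K' τ)
    have h1 : |⟪shellVec X ((K' : ℤ) + 1) τ, tableA α (shellVec X K' τ)⟫| ≤
        (Real.sqrt m * M) * (fluxConst α * (‖shellVec X (K' : ℤ) τ‖ * ‖shellVec X (K' : ℤ) τ‖)) := by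
      refine (abs_real_inner_le_norm _ _).trans ?_
      rw [← sq]
      exact mul_le_mul (hxle' τ hτ _) hA (norm_nonneg _) (by positivity)
    -- one factor of `‖x_{K'}‖` carries the weight
    have h2 : ‖shellVec X (K' : ℤ) τ‖ * ‖shellVec X (K' : ℤ) τ‖ ≤
        (Real.sqrt m * M) * (Real.sqrt m * (M / (1 + (1 + ε₀) ^ ((10 : ℝ) * ((K' : ℤ) : ℝ))))) :=
      mul_le_mul (hxle' τ hτ _) (hxle τ hτ _) (norm_nonneg _) (by positivity)
    have hW : ((1 + ε₀) ^ (10 : ℝ)) ^ K' ≤ 1 + (1 + ε₀) ^ ((10 : ℝ) * ((K' : ℤ) : ℝ)) := by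
      have : ((1 + ε₀) ^ (10 : ℝ)) ^ K' = (1 + ε₀) ^ ((10 : ℝ) * ((K' : ℤ) : ℝ)) := by
        rw [← Real.rpow_natCast, ← Real.rpow_mul hl0.le]; push_cast; ring_nf
      linarith
    have hW0 : 0 < ((1 + ε₀) ^ (10 : ℝ)) ^ K' := pow_pos hP10 _
    have h3 : M / (1 + (1 + ε₀) ^ ((10 : ℝ) * ((K' : ℤ) : ℝ))) ≤ M / ((1 + ε₀) ^ (10 : ℝ)) ^ K' :=
      div_le_div_of_nonneg_left hM0 hW0 hW
    have hΛK : bigLam ε₀ ^ ((K' : ℤ)) = bigLam ε₀ ^ K' := zpow_natCast _ _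
    simp only [hfdef]
    rw [abs_mul, abs_mul, abs_two, hΛK, abs_of_pos (pow_pos hL _)]
    have hsm : 0 ≤ Real.sqrt m := Real.sqrt_nonneg _
    calc 2 * bigLam ε₀ ^ K' * |⟪shellVec X ((K' : ℤ) + 1) τ, tableA α (shellVec X (K' : ℤ) τ)⟫|
        ≤ 2 * bigLam ε₀ ^ K' * ((Real.sqrt m * M) * (fluxConst α *
            ((Real.sqrt m * M) * (Real.sqrt m * (M / ((1 + ε₀) ^ (10 : ℝ)) ^ K'))))) := by
          refine mul_le_mul_of_nonneg_left (h1.trans ?_) (by positivity)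
          refine mul_le_mul_of_nonneg_left (mul_le_mul_of_nonneg_left (h2.trans ?_)
            (fluxConst_nonneg α)) (by positivity)
          exact mul_le_mul_of_nonneg_left (mul_le_mul_of_nonneg_left h3 hsm) (by positivity)
      _ = Cf * (bigLam ε₀ ^ K' / ((1 + ε₀) ^ (10 : ℝ)) ^ K') := by
          simp only [hCfdef]; field_simp
      _ = Cf * q ^ K' := by rw [hqdef, div_pow]
  -- the partial energy at time `0` is the datum energy
  have hS0 : ∀ K' : ℕ, S K' 0 = ∑ i, X₀ i ^ 2 := by
    intro K'
    simp only [hSdef]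
    rw [Finset.sum_eq_single 0]
    · rw [EuclideanSpace.norm_eq, Real.sq_sqrt (Finset.sum_nonneg fun i _ => by positivity)]
      refine Finset.sum_congr rfl fun i _ => ?_
      simp [shellVec, hinit]
    · intro k _ hk
      have : shellVec X (k : ℤ) 0 = 0 := by
        ext i
        simp [shellVec, hinit, hk]
      rw [this, norm_zero, zero_pow two_ne_zero]
    · intro h; exact absurd (Finset.mem_range.2 (Nat.succ_pos K')) h
  -- mean value: `|S K' t - S K' 0| ≤ Cf q^{K'} t`
  have hSt : ∀ K' : ℕ, S K' t ≤ ∑ i, X₀ i ^ 2 + Cf * q ^ K' * t := by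
    intro K'
    have hd : ∀ τ ∈ Icc (0 : ℝ) t, HasDerivWithinAt (S K') (-(f K' τ)) (Icc 0 t) τ :=
      fun τ hτ => (hSder K' τ hτ).mono Icc_subset_Ici_self
    have key := norm_image_sub_le_of_norm_deriv_le_segment' hd
      (fun τ hτ => by rw [norm_neg, Real.norm_eq_abs]; exact hfbound K' τ ⟨hτ.1, hτ.2.le⟩) t
      (right_mem_Icc.2 ht.1)
    rw [Real.norm_eq_abs, hS0, sub_zero] at key
    linarith [(abs_le.1 key).2]
  -- let `K' → ∞`
  refine le_of_forall_pos_lt_add fun η hη => ?_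
  obtain ⟨N, hN⟩ := exists_pow_lt_of_lt_one (show 0 < η / (Cf * t + 1) from
    div_pos hη (by nlinarith [hCf0, ht.1])) hq1
  set K' := max K N with hK'def
  have hmono : S K t ≤ S K' t := by
    simp only [hSdef]
    exact Finset.sum_le_sum_of_subset_of_nonneg
      (Finset.range_mono (Nat.succ_le_succ (le_max_left K N))) fun _ _ _ => by positivity
  have hqK : q ^ K' ≤ q ^ N := pow_le_pow_of_le_one hq0 hq1.le (le_max_right _ _)
  have hsmall : Cf * q ^ K' * t < η := by
    have h1 : Cf * q ^ K' * t ≤ Cf * q ^ N * t := by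
      have := mul_le_mul_of_nonneg_left hqK hCf0
      exact mul_le_mul_of_nonneg_right this ht.1
    have h2 : Cf * q ^ N * t ≤ (Cf * t + 1) * q ^ N := by nlinarith [pow_nonneg hq0 N, ht.1]
    have h3 : (Cf * t + 1) * q ^ N < η := by
      have := hN
      rwa [lt_div_iff₀ (by nlinarith [hCf0, ht.1]), mul_comm] at this
    linarith
  calc ∑ k ∈ Finset.range (K + 1), ‖shellVec X (k : ℤ) t‖ ^ 2 = S K t := rfl
    _ ≤ S K' t := hmono
    _ ≤ ∑ i, X₀ i ^ 2 + Cf * q ^ K' * t := hSt K'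
    _ < ∑ i, X₀ i ^ 2 + η := by linarith

/-- **AMPLITUDE BOUND**: under the hypotheses of `partialEnergy_le_datumEnergy`, every mode obeys
`|X_{i,k}(t)| ≤ √(Σ_j X₀ⱼ²)` on `[0,T)`. [cite: Tao2016AveragedNS, §4 (4.3), Lemma 4.1 (4.9)–(4.10)] -/
theorem abs_le_datumNorm {ε₀ T : ℝ} (hε : 0 < ε₀)
    {α : Fin m → Fin m → Fin m → ℤ × ℤ × ℤ → ℝ} (hc : IsCancellingCoeff α)
    {X : Fin m → ℤ → ℝ → ℝ} {X₀ : Fin m → ℝ}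
    (hder : ∀ i k, ∀ t ∈ Ico 0 T, HasDerivWithinAt (X i k) (quadTerm ε₀ α X i k t) (Ici 0) t)
    (hinit : ∀ i k, X i k 0 = if k = 0 then X₀ i else 0)
    (hlow : ∀ i k t, k < 0 → X i k t = 0)
    (hreg : ∀ T' : ℝ, T' < T → ∃ M : ℝ, ∀ t ∈ Icc 0 T', ∀ (i : Fin m) (k : ℤ),
      (1 + (1 + ε₀) ^ ((10 : ℝ) * k)) * |X i k t| ≤ M) :
    ∀ t ∈ Ico 0 T, ∀ (i : Fin m) (k : ℤ), |X i k t| ≤ Real.sqrt (∑ j, X₀ j ^ 2) := by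
  intro t ht i k
  rcases lt_or_ge k 0 with hk | hk
  · rw [hlow i k t hk, abs_zero]; exact Real.sqrt_nonneg _
  · obtain ⟨n, rfl⟩ := Int.eq_ofNat_of_zero_le hk
    have hE := partialEnergy_le_datumEnergy hε hc hder hinit hlow hreg t ht n
    have h1 : ‖shellVec X (n : ℤ) t‖ ^ 2 ≤ ∑ k ∈ Finset.range (n + 1), ‖shellVec X (k : ℤ) t‖ ^ 2 :=
      Finset.single_le_sum (f := fun k : ℕ => ‖shellVec X (k : ℤ) t‖ ^ 2) (fun _ _ => by positivity)
        (Finset.mem_range.2 (Nat.lt_succ_self n))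
    have h2 : |X i (n : ℤ) t| ^ 2 ≤ ‖shellVec X (n : ℤ) t‖ ^ 2 := by
      rw [EuclideanSpace.norm_eq, Real.sq_sqrt (Finset.sum_nonneg fun j _ => by positivity)]
      have := Finset.single_le_sum (f := fun j => ‖shellVec X (n : ℤ) t j‖ ^ 2)
        (fun _ _ => by positivity) (Finset.mem_univ i)
      simpa [shellVec, Real.norm_eq_abs] using this
    rw [← Real.sqrt_sq (abs_nonneg (X i (n : ℤ) t))]
    exact Real.sqrt_le_sqrt (by linarith)

/-! ### Robust blow-up cascades to arbitrarily high shells -/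

/-- **THE BLOW-UP ESCAPES TO ARBITRARILY HIGH SHELLS.** If `NoGlobalCascade ε₀ α X₀` (`ε₀ > 0`,
`α ∈ E₂(R)`, any `m`), then along the maximal exact cascade flow `X` from the one-shell datum (on
`[0,T⋆)`: `C¹`, datum, no shells below `0`, exact motion, (4.5)-regular before `T⋆`) every amplitude is
bounded by the datum norm, `|X_{i,k}(t)| ≤ √(Σ_j X₀ⱼ²)`, and for every shell index `K` and every level `L`
there are `t < T⋆`, a mode `i` and a shell `k > K` with `(1+ε₀)^{5k/2}|X_{i,k}(t)| > L`: the unbounded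
critical amplitude (`criticalBlowup_of_noGlobalCascade`) is realised on shells `k → ∞`.
[cite: Tao2016AveragedNS, §4 Thm. 4.2, (4.3), (4.12); Teschl2012, §2.6] -/
theorem highShellBlowup_of_noGlobalCascade {ε₀ R : ℝ} (hε : 0 < ε₀)
    {α : Fin m → Fin m → Fin m → ℤ × ℤ × ℤ → ℝ} {X₀ : Fin m → ℝ} (hα : InTableClass R α)
    (hNG : NoGlobalCascade ε₀ α X₀) :
    ∃ (T : ℝ) (X : Fin m → ℤ → ℝ → ℝ), 0 < T ∧
      (∀ i n, ContDiffOn ℝ 1 (X i n) (Set.Ico 0 T)) ∧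
      (∀ i n, X i n 0 = if n = 0 then X₀ i else 0) ∧
      (∀ i n t, n < 0 → X i n t = 0) ∧
      (∀ i n t, 0 ≤ t → t < T → derivWithin (X i n) (Set.Ici 0) t = quadTerm ε₀ α X i n t) ∧
      (∀ T' : ℝ, 0 < T' → T' < T → ∃ M : ℝ, ∀ t : ℝ, 0 ≤ t → t ≤ T' →
        ∀ (i : Fin m) (n : ℤ), (1 + (1 + ε₀) ^ ((10 : ℝ) * n)) * |X i n t| ≤ M) ∧
      (∀ t ∈ Ico (0 : ℝ) T, ∀ (i : Fin m) (k : ℤ), |X i k t| ≤ Real.sqrt (∑ j, X₀ j ^ 2)) ∧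
      (∀ (K : ℤ) (L : ℝ), ∃ t : ℝ, 0 ≤ t ∧ t < T ∧
        ∃ (i : Fin m) (k : ℤ), K < k ∧ L < (1 + ε₀) ^ ((5 : ℝ) * k / 2) * |X i k t|) := by
  obtain ⟨T, X, hT, h1, h2, h3, h4, h5, h6⟩ := criticalBlowup_of_noGlobalCascade hε hα hNG
  have hl1 : (1 : ℝ) ≤ 1 + ε₀ := by linarith
  have hder : ∀ i k, ∀ τ ∈ Ico (0 : ℝ) T,
      HasDerivWithinAt (X i k) (quadTerm ε₀ α X i k τ) (Ici 0) τ := by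
    intro i k τ hτ
    have hd : DifferentiableWithinAt ℝ (X i k) (Ico 0 T) τ :=
      ((h1 i k).differentiableOn one_ne_zero) τ hτ
    have hd' : DifferentiableWithinAt ℝ (X i k) (Ici 0) τ :=
      hd.mono_of_mem_nhdsWithin (by
        rw [mem_nhdsWithin]
        exact ⟨Iio T, isOpen_Iio, hτ.2, fun x hx => ⟨hx.2, hx.1⟩⟩)
    rw [← h4 i k τ hτ.1 hτ.2]
    exact hd'.hasDerivWithinAt
  have hreg : ∀ T' : ℝ, T' < T → ∃ M : ℝ, ∀ τ ∈ Icc (0 : ℝ) T', ∀ (i : Fin m) (k : ℤ),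
      (1 + (1 + ε₀) ^ ((10 : ℝ) * k)) * |X i k τ| ≤ M := by
    intro T' hT'
    rcases le_or_gt T' 0 with h0 | h0
    · obtain ⟨M, hM⟩ := h5 (T / 2) (by linarith) (by linarith)
      exact ⟨M, fun τ hτ i k => hM τ hτ.1 (by linarith [hτ.2]) i k⟩
    · obtain ⟨M, hM⟩ := h5 T' h0 hT'
      exact ⟨M, fun τ hτ i k => hM τ hτ.1 hτ.2 i k⟩
  have hamp := abs_le_datumNorm hε hα.2.1 hder h2 h3 hreg
  refine ⟨T, X, hT, h1, h2, h3, h4, h5, hamp, fun K L => ?_⟩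
  set D : ℝ := Real.sqrt (∑ j, X₀ j ^ 2) with hDdef
  have hD0 : 0 ≤ D := Real.sqrt_nonneg _
  obtain ⟨t, ht0, htT, i, k, hlt⟩ := h6 (max L ((1 + ε₀) ^ ((5 : ℝ) * K / 2) * D))
  refine ⟨t, ht0, htT, i, k, ?_, lt_of_le_of_lt (le_max_left _ _) hlt⟩
  by_contra hkK
  have hkK : k ≤ K := not_lt.1 hkK
  have hpow : (1 + ε₀) ^ ((5 : ℝ) * k / 2) ≤ (1 + ε₀) ^ ((5 : ℝ) * K / 2) := by
    refine Real.rpow_le_rpow_of_exponent_le hl1 ?_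
    have : (k : ℝ) ≤ K := by exact_mod_cast hkK
    linarith
  have hle : (1 + ε₀) ^ ((5 : ℝ) * k / 2) * |X i k t| ≤ (1 + ε₀) ^ ((5 : ℝ) * K / 2) * D :=
    mul_le_mul hpow (hamp t ⟨ht0, htT⟩ i k) (abs_nonneg _) (Real.rpow_nonneg (by linarith) _)
  exact absurd (lt_of_le_of_lt (le_max_right _ _) hlt) (not_lt.2 hle)

end BlowupRigidityOne

end Summit.NavierStokesRegularity.NavierStokesRegularity.Theorems

end
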